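/-
Copyright (c) 2026 the pub-hodgecm-mathlib formalisation cell (harness21).  Prover seat hodgecm-mathlib-K2E3-p06 (g0), Track B «K2-LIT» ∕ h413,
ENGINE E3 unit U4 «Keys», SIGS-TABLE row #6 `sig_K2E3IrregularReducibleCaseThree` — helper 1 (representation-theoretic half).  2026-09-03.
-/
import Summits.HodgeConjecture.HodgeConjecture.Theorems.F0P3cStCharTSLdsRedTwoOfReducible        -- ★ brings «PS-UNITARY★», N1 ∕ N2 ∕ N3 holds, `finrank_coinvariants_eq_one_of_ne_bot_of_ne_top`, `isSmooth_cmPrincipalSeries`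
import Summits.HodgeConjecture.HodgeConjecture.Theorems.F0P3cStCharTSKeys3JacquetSemisimple       -- ★ brings the packages HC `closedCell_cmPrincipalSeries`, HU `finrank_le_one_cmPrincipalSeries`, HT (N1 T-ℓ)
import Summits.HodgeConjecture.HodgeConjecture.Theorems.F0P3cStCharTSWeylFixedIffNormTrivial     -- ★ `cmWeylTorusCharPair_eq_iff` (`wχ = χ ⟺ χ₁(σα · α) = 1`)
import Summits.HodgeConjecture.HodgeConjecture.Theorems.F0P3UnipotentLimitCompactOpen            -- ★ `isLimitOfCompactOpen_cmUnipotentU`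
import Literature.NumberTheory.Automorphic.JacquetLineExponents                                   -- ★ `Representation.jacquetMap_normalizedJacquet`
import HarnessLib

/-!
# K2 · E3 · U4 «Keys», row #6 `sig_K2E3IrregularReducibleCaseThree` — helper 1 «JACQUET SCALAR OF A REDUCIBLE `w`-FIXED `i_G(χ)`»:
# at a non-split `v`, for continuous `χ = (χ₁, χ₂)` with `wχ = χ`, a REDUCIBLE `i_G(χ)` of `U(Φ₃)(L⁺_v)` has `T` acting on its whole normalised
# Jacquet module `r_B i_G(χ)` by the scalar `χ` [Keys1984 §3 Thms. 1–3, §7 Thm. (1); Casselman1995 §6.3–6.4; BernsteinZelevinsky1977 §2.3]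

Cell `pub/hodgecm-mathlib` (D-0151), HCML Track B «K2-LIT», crux H413 = `stmt-HodgeConjecture-24833` (lane `--supports … --as helper`), route
HCCMUnconditional; socket `sig_K2E3IrregularReducibleCaseThree` (U4-c) of `Cruxes/H413/Lines/K2_E3_EllipticInputsSigs_U4Keys.lean` (K2E3-plan (g0), frozen):
«`v` non-split, `χ₁, χ₂` continuous, `(χ₁, χ₂) = w(χ₁, χ₂)`, `i_G(χ₁, χ₂)` has a `G`-stable `⊥ ≠ N ≠ ⊤` ⟹ `χ₁ ≠ 1 ∧ χ₁|_{F_v^×} = 1`» — the IRREDUCIBILITY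
half of Keys' theorem for the unitary principal series («`Ind_P^G λ` is reducible if and only if `λ ≠ 1`, `wλ = λ`, and `λ|F^× = 1`»).  THEOREMS ONLY
(0 def ∕ 0 instance ∕ 0 notation ∕ 0 sorry); ★-only imports.

THE MATHEMATICS (Keys' criterion read on the Jacquet module).  `dim End_G i_G(χ) = dim Hom_T(r_B i_G(χ), χ δ^{1/2})` (Frobenius), and `r_B i_G(χ)` is
two-dimensional with a `T`-stable line `ℓ` on which `T` acts by `wχ` and quotient `χ` (★ N1, ★ closed cell).  When `wχ = χ` the operator `r_B(m) − χ(m)` is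
therefore NILPOTENT of order two, and `i_G(χ)` is reducible iff `r_B i_G(χ)` is SEMISIMPLE (the `R`-group of [Keys1984, §3] has order `2` iff the normalised
intertwining operator is not a scalar).  This file proves the direction needed by the socket: REDUCIBLE ⟹ `r_B(m) = χ(m) · id`:
`i_G(χ)` is unitary for `wχ = χ` (§1: `χ₁(σα · α) = 1` and the compactness of `E¹_v` give `|χ₁| = 1`), hence completely reducible (★ «PS-UNITARY★»), so a
`G`-stable `⊥ ≠ N ≠ ⊤` has an invariant complement `N'`; `r_B(N)`, `r_B(N')` are LINES ([Casselman1995, Prop. 7.1.3], ★ `finrank_coinvariants_eq_one_of_ne_bot_of_ne_top`)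
whose images span `r_B i_G(χ)` and are `T`-stable; on a stable line a scalar `a` with `(a − χ(m))² = 0` is `χ(m)` (§2); hence §3.
* §1 `norm_apply_eq_one_of_apply_conj_mul_eq_one`, `norm_cmTorusCharPair_eq_one_of_weylFixed` — unitarity of a continuous `w`-fixed pair at a non-split `v`.
* §2 `apply_eq_smul_of_mem_stable_line`, `apply_eq_smul_of_stable_lines` — plain linear algebra in the letters of the ★ packages HC ∕ HU ∕ HT (as ★ B6a §2).
* §3 **`normalizedJacquet_eq_smul_of_reducible`** — `v` non-split, `χ₁, χ₂` continuous, `cmWeylTorusCharPair = cmTorusCharPair`, `∃ N, ⊥ ≠ N ≠ ⊤` ⟹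
  `∀ m x, r_B(m) x = χ(m) • x`; and **`normalizedJacquet_eq_smul_of_reducible_irregular`**, the same under the SOCKET's spelling of `wχ = χ`
  (`cmTorusCharPair L v χ₁ χ₂ = cmTorusCharPair L v (conjInvChar … χ₁) χ₂`).
CONSUMER: helper 2 `K2E3IrregularReducibleCaseThreeChiOneNeOne` (★ D1 split test ⟹ all cell integrals vanish ⟹ annulus integrals of the cell function vanish ⟹
`χ₁ ≠ 1`), i.e. the FIRST conjunct of the socket; the second conjunct (`χ₁|_{F_v^×} = 1`) needs in addition the non-vanishing of the skew-line integral
`∫_{E_v⁻} χ₁(1+η) ‖1+η‖⁻¹ dη` for `χ₁|_{F_v^×} = ω_{E/F}` ([Keys1984, §5]: Plancherel measure), not claimed here.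
HONEST LABEL: HC_CM is proved only modulo the 7 printed citations (2 remaining named inputs: hLiu418 = `stmt-HodgeConjecture-24832`, h413 =
`stmt-HodgeConjecture-24833`) until rung 0 closes; this file pays no socket by itself.

## References
* [Keys1984] D. Keys, *Principal series representations of special unitary groups over local fields*, Compositio Math. 51 (1984), §3 Thms. 1–3 pp. 118–119; §7 Thm. (1) p. 126.
* [Rogawski1990] J. D. Rogawski, *Automorphic Representations of Unitary Groups in Three Variables*, Ann. of Math. Stud. 123 (1990), §12.1 p. 171; §12.2 (3) pp. 173–174.
* [Casselman1995] W. Casselman, *Introduction to the theory of admissible representations of p-adic reductive groups* (1995), §3.2, §6.3–§6.4, Lemma 7.1.1 (a), Prop. 7.1.3.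
* [BernsteinZelevinsky1977] I. N. Bernstein, A. V. Zelevinsky, Ann. Sci. ÉNS 10 (1977), Prop. 1.9, §2.3, Geometrical Lemma 2.12.
* [BernsteinZelevinsky1976] I. N. Bernstein, A. V. Zelevinsky, Russian Math. Surveys 31:3 (1976), 2.25 (c).
-/

set_option autoImplicit false
-- the mandated namespace has the single-problem summit's repeated segment (`HodgeConjecture.HodgeConjecture`)
set_option linter.dupNamespace false

noncomputable section

open NumberField IsDedekindDomain
open scoped Matrix
open Literature.NumberTheory.Rogawski1990 Literature.NumberTheory.Automorphic Literature.NumberTheory.Automorphic.UnitaryGroup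
open Literature.RepresentationTheory.FiniteGroups

namespace Summit.HodgeConjecture.HodgeConjecture.Cruxes.H413.K2E3IrregularReducibleCaseThreeJacquetScalar

/-! ## §1 A continuous `w`-fixed pair is unitary (non-split `v`) -/

section Unitary

variable (L : Type) [Field L] [NumberField L] [IsCMField L] (v : HeightOneSpectrum (𝓞 ↥(maximalRealSubfield L)))
  (hns : ∀ w : PlacesOver L v, IsCMField.complexConj L • w.1 = w.1)

include hns in
/-- **A continuous character `χ₁` of `E_v^×` trivial on the norms `σ(x) · x` is unitary** (`v` non-split): `χ₁(σ x) = χ₁(x)⁻¹` by hypothesis, and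
`σ(x) · x⁻¹ ∈ E¹_v` (compact, ★ `compactSpace_normOneUnits`) gives `|χ₁(σ x)| = |χ₁(x)|` (★ `norm_apply_normOneUnits_eq_one`); so `|χ₁(x)|² = 1`.  (The `w`-FIXED
characters `χ₁ = χ̄₁⁻¹` of [Rogawski1990, §12.2] are unitary.) [cite: Rogawski1990, §12.2 p. 173] [cite: Keys1984, §7 Thm. (1) p. 126] -/
theorem norm_apply_eq_one_of_apply_conj_mul_eq_one (χ₁ : (LocalRing L v)ˣ →* ℂˣ) (h1 : Continuous fun x => ((χ₁ x : ℂˣ) : ℂ))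
    (hnorm : ∀ α : (LocalRing L v)ˣ, χ₁ (Units.map (conjLocal L (IsCMField.complexConj L) v : LocalRing L v →* LocalRing L v) α) * χ₁ α = 1)
    (x : (LocalRing L v)ˣ) : ‖((χ₁ x : ℂˣ) : ℂ)‖ = 1 := by
  -- `σ` on units
  set σu : (LocalRing L v)ˣ →* (LocalRing L v)ˣ := Units.map (conjLocal L (IsCMField.complexConj L) v : LocalRing L v →* LocalRing L v) with hσu
  have hσu_coe : ∀ y : (LocalRing L v)ˣ, ((σu y : (LocalRing L v)ˣ) : LocalRing L v) = conjLocal L (IsCMField.complexConj L) v (y : LocalRing L v) :=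
    fun y => rfl
  have hσσ : ∀ y : LocalRing L v, conjLocal L (IsCMField.complexConj L) v (conjLocal L (IsCMField.complexConj L) v y) = y :=
    conjLocal_conjLocal_cm L v
  have hσuσu : σu (σu x) = x := Units.ext (by rw [hσu_coe, hσu_coe, hσσ])
  -- (a) `χ₁(σ x) = χ₁(x)⁻¹`
  have ha : χ₁ (σu x) = (χ₁ x)⁻¹ := eq_inv_of_mul_eq_one_left (hnorm x)
  -- (b) `|χ₁(σ x)| = |χ₁ x|`: `σ x · x⁻¹ ∈ E¹_v`
  have hmem : σu x * x⁻¹ ∈ normOneUnits (conjLocal L (IsCMField.complexConj L) v) := by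
    rw [UnitaryGroup.mem_normOneUnits_iff, ← hσu_coe, ← Units.val_mul, map_mul, map_inv, hσuσu,
      show x * (σu x)⁻¹ * (σu x * x⁻¹) = 1 by group, Units.val_one]
  have hb : ‖((χ₁ (σu x) : ℂˣ) : ℂ)‖ = ‖((χ₁ x : ℂˣ) : ℂ)‖ := by
    have hres : Continuous fun b : ↥(normOneUnits (conjLocal L (IsCMField.complexConj L) v)) =>
        (((χ₁.comp (normOneUnits (conjLocal L (IsCMField.complexConj L) v)).subtype) b : ℂˣ) : ℂ) :=
      h1.comp continuous_subtype_val
    have hu := F0P3cStCharTSPrincipalSeriesUnitary.norm_apply_normOneUnits_eq_one L v hns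
      (χ₁.comp (normOneUnits (conjLocal L (IsCMField.complexConj L) v)).subtype) hres ⟨_, hmem⟩
    simp only [MonoidHom.comp_apply, Subgroup.subtype_apply, map_mul, map_inv, Units.val_mul, Units.val_inv_eq_inv_val, norm_mul, norm_inv] at hu
    have hx0 : ‖((χ₁ x : ℂˣ) : ℂ)‖ ≠ 0 := norm_ne_zero_iff.2 (χ₁ x).ne_zero
    exact (mul_inv_eq_one₀ hx0).1 hu
  -- (c) `|χ₁ x|⁻¹ = |χ₁ x|`, `|χ₁ x| > 0`
  rw [ha, Units.val_inv_eq_inv_val, norm_inv] at hb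
  have hpos : 0 < ‖((χ₁ x : ℂˣ) : ℂ)‖ := norm_pos_iff.2 (χ₁ x).ne_zero
  have hsq : ‖((χ₁ x : ℂˣ) : ℂ)‖ * ‖((χ₁ x : ℂˣ) : ℂ)‖ = 1 := by
    nth_rewrite 1 [← hb]
    exact inv_mul_cancel₀ hpos.ne'
  nlinarith [hpos, hsq]

include hns in
/-- **`|χ(t)| = 1` for a continuous `w`-FIXED pair `χ = (χ₁, χ₂)`** (`cmWeylTorusCharPair L v χ₁ χ₂ = cmTorusCharPair L v χ₁ χ₂`, i.e. `χ₁(σα · α) = 1` for all `α`,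
★ `cmWeylTorusCharPair_eq_iff`), `v` non-split: `χ₁` by `norm_apply_eq_one_of_apply_conj_mul_eq_one`, `χ₂` by ★ `norm_apply_normOneUnits_eq_one`.
[cite: Rogawski1990, §12.1 p. 171; §12.2 p. 173] -/
theorem norm_cmTorusCharPair_eq_one_of_weylFixed (χ₁ : (LocalRing L v)ˣ →* ℂˣ) (χ₂ : ↥(normOneUnits (conjLocal L (IsCMField.complexConj L) v)) →* ℂˣ)
    (h1 : Continuous fun x => ((χ₁ x : ℂˣ) : ℂ)) (h2 : Continuous fun x => ((χ₂ x : ℂˣ) : ℂ))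
    (hw : cmWeylTorusCharPair L v χ₁ χ₂ = cmTorusCharPair L v χ₁ χ₂)
    (t : ↥(torusU (conjLocal L (IsCMField.complexConj L) v) (cmLocalForm L 3 v))) :
    ‖((cmTorusCharPair L v χ₁ χ₂ t : ℂˣ) : ℂ)‖ = 1 := by
  have hnorm := (F0P3cStCharTSWeylFixedIffNormTrivial.cmWeylTorusCharPair_eq_iff L v χ₁ χ₂).1 hw
  rw [cmTorusCharPair, torusCharPair_apply, Units.val_mul, norm_mul, norm_apply_eq_one_of_apply_conj_mul_eq_one L v hns χ₁ h1 hnorm,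
    F0P3cStCharTSPrincipalSeriesUnitary.norm_apply_normOneUnits_eq_one L v hns χ₂ h2, one_mul]

end Unitary

/-! ## §2 Linear algebra: a scalar on a stable line squares against the nilpotent `r_B(m) − χ(m)` -/

section Linear

variable {C S M : Type*} [AddCommGroup C] [Module ℂ C]

/-- **On a `J m`-stable finite-dimensional subspace of dimension `≤ 1`, `J m = χ(m)`** whenever `(J m − χ m) C ⊆ ℓ` and `J m|_ℓ = χ m` (so `(J m − χ m)² = 0`):
on the line `ℂ x`, `J x = a • x` and `(a − χ m) • x ∈ ℓ`; either `a = χ m`, or `x ∈ ℓ` where `J = χ m`. [cite: Keys1984, §3 Thms. 1–3 pp. 118–119] [cite: Casselman1995, §6.4] -/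
theorem apply_eq_smul_of_mem_stable_line (J : C → C) (c : ℂ) (hJsmul : ∀ (a : ℂ) x, J (a • x) = a • J x)
    (ℓ : Submodule ℂ C) (hJℓ : ∀ x, J x - c • x ∈ ℓ) (hline : ∀ y ∈ ℓ, J y = c • y)
    (A : Submodule ℂ C) [FiniteDimensional ℂ ↥A] (hrA : Module.finrank ℂ ↥A ≤ 1) (hA : ∀ x ∈ A, J x ∈ A) (x : C) (hx : x ∈ A) :
    J x = c • x := by
  by_cases hx0 : x = 0
  · subst hx0
    have h0 : J 0 = 0 := by
      have := hJsmul 0 0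
      rwa [zero_smul, zero_smul] at this
    rw [h0, smul_zero]
  -- `A` is the line `ℂ x`, so `J x = a • x`
  have hxA0 : (⟨x, hx⟩ : ↥A) ≠ 0 := fun h => hx0 (congrArg Subtype.val h)
  have hrk1 : Module.finrank ℂ ↥A = 1 := le_antisymm hrA (Module.finrank_pos_iff_exists_ne_zero.2 ⟨_, hxA0⟩)
  obtain ⟨a, ha⟩ := (finrank_eq_one_iff_of_nonzero' (⟨x, hx⟩ : ↥A) hxA0).1 hrk1 ⟨J x, hA x hx⟩
  have ha' : J x = a • x := by
    have := congrArg Subtype.val ha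
    simpa only [SetLike.mk_smul_mk] using this.symm
  -- `(a − c) • x ∈ ℓ`: either `a = c`, or `x ∈ ℓ` and `J x = c • x` on `ℓ`
  have hy : (a - c) • x ∈ ℓ := by rw [sub_smul, ← ha']; exact hJℓ x
  by_cases hb : a - c = 0
  · rw [ha', sub_eq_zero.1 hb]
  · exact hline x ((Submodule.smul_mem_iff ℓ hb).1 hy)

/-- **`J m = χ m · id` from two stable lines spanning `C`** — the letters of the ★ packages (HC = ★ `closedCell_cmPrincipalSeries`, HU = ★ `finrank_le_one_cmPrincipalSeries`,
HT = ★ N1 (T-ℓ) `torus_normalizedJacquet_openCellLine_eq_weylChar`, `hw : wχ = χ`, as in ★ B6a `apply_eq_smul_of_one_vector`) plus two `J m`-stable finite-dimensional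
subspaces `A, B` of dimension `≤ 1` with `A + B ∋ x` for every `x` (the Jacquet images of a subrepresentation and of its invariant complement).
[cite: Keys1984, §3 Thms. 1–3 pp. 118–119; §7 Thm. (1) p. 126] [cite: Casselman1995, §6.3, Lemma 7.1.1 (a)] [cite: BernsteinZelevinsky1977, Geometrical Lemma 2.12] -/
theorem apply_eq_smul_of_stable_lines (mk : S → C) (ev : S → ℂ) (J : M → C → C) (χc wχc : M → ℂ)
    (hJadd : ∀ m x y, J m (x + y) = J m x + J m y) (hJsmul : ∀ (m) (c : ℂ) x, J m (c • x) = c • J m x)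
    (HC : ∃ ℓ : Submodule ℂ C, (∀ m, ∀ x ∈ ℓ, J m x ∈ ℓ) ∧ (∀ m x, J m x - χc m • x ∈ ℓ) ∧
      FiniteDimensional ℂ (C ⧸ ℓ) ∧ Module.finrank ℂ (C ⧸ ℓ) ≤ 1 ∧ (∀ x, x ∈ ℓ ↔ ∃ f, ev f = 0 ∧ mk f = x))
    (HU : ∀ ℓ : Submodule ℂ C, (∀ x, x ∈ ℓ ↔ ∃ f, ev f = 0 ∧ mk f = x) → FiniteDimensional ℂ ↥ℓ ∧ Module.finrank ℂ ↥ℓ ≤ 1)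
    (HT : ∀ ℓ : Submodule ℂ C, (∀ x ∈ ℓ, ∃ f, ev f = 0 ∧ mk f = x) → (∀ f, ev f = 0 → mk f ∈ ℓ) →
      FiniteDimensional ℂ ↥ℓ → Module.finrank ℂ ↥ℓ ≤ 1 → ∀ m, ∀ x ∈ ℓ, J m x = wχc m • x)
    (hw : ∀ m, wχc m = χc m)
    (A B : Submodule ℂ C) (hfA : FiniteDimensional ℂ ↥A) (hfB : FiniteDimensional ℂ ↥B) (hrA : Module.finrank ℂ ↥A ≤ 1) (hrB : Module.finrank ℂ ↥B ≤ 1)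
    (hA : ∀ m, ∀ x ∈ A, J m x ∈ A) (hB : ∀ m, ∀ x ∈ B, J m x ∈ B) (hsum : ∀ x : C, ∃ a ∈ A, ∃ b ∈ B, x = a + b)
    (m : M) (x : C) : J m x = χc m • x := by
  haveI := hfA
  haveI := hfB
  obtain ⟨ℓ, -, hJℓ, -, -, hℓ⟩ := HC
  obtain ⟨hfdℓ, hrkℓ⟩ := HU ℓ hℓ
  have hline : ∀ y ∈ ℓ, J m y = χc m • y := fun y hy => by
    rw [← hw]; exact HT ℓ (fun z hz => (hℓ z).1 hz) (fun f hf => (hℓ _).2 ⟨f, hf, rfl⟩) hfdℓ hrkℓ m y hy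
  obtain ⟨a, ha, b, hb, rfl⟩ := hsum x
  rw [hJadd, smul_add,
    apply_eq_smul_of_mem_stable_line (J m) (χc m) (hJsmul m) ℓ (hJℓ m) hline A hrA (hA m) a ha,
    apply_eq_smul_of_mem_stable_line (J m) (χc m) (hJsmul m) ℓ (hJℓ m) hline B hrB (hB m) b hb]

end Linear

/-! ## §3 The Jacquet images of two complementary subrepresentations with one-dimensional Jacquet modules (generic parabolic triple) -/

section GenericJacquet

variable {G V : Type*} [Group G] [TopologicalSpace G] [IsTopologicalGroup G] [AddCommGroup V] [Module ℂ V]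
  (t : ParabolicTriple G) [LocallyCompactSpace ↥t.P]

/-- **Two subrepresentations `N, N'` with `N + N' = V` and ONE-DIMENSIONAL Jacquet modules give two `r_P(m)`-stable lines spanning `r_P V`**: the images of
`r_P N → r_P V`, `r_P N' → r_P V` (functoriality ★ `Representation.jacquetMap`, ★ `jacquetMap_normalizedJacquet`; `[f] = [n] + [n']` for `f = n + n'`).  Generic in the
parabolic triple; the letters `A, B` of `apply_eq_smul_of_stable_lines`. [cite: BernsteinZelevinsky1977, Prop. 1.9, §2.3] [cite: Casselman1995, §3.2, Prop. 7.1.3] -/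
theorem exists_stable_lines_of_sup_eq_top (ρ : Representation ℂ G V) (N N' : Subrepresentation ρ) (hsup : N.toSubmodule ⊔ N'.toSubmodule = ⊤)
    (hN : Module.finrank ℂ (t.restrict N.toRepresentation).Coinvariants = 1) (hN' : Module.finrank ℂ (t.restrict N'.toRepresentation).Coinvariants = 1) :
    ∃ A B : Submodule ℂ (t.restrict ρ).Coinvariants,
      FiniteDimensional ℂ ↥A ∧ FiniteDimensional ℂ ↥B ∧ Module.finrank ℂ ↥A ≤ 1 ∧ Module.finrank ℂ ↥B ≤ 1 ∧
      (∀ m : ↥t.M, ∀ x ∈ A, ρ.normalizedJacquet t m x ∈ A) ∧ (∀ m : ↥t.M, ∀ x ∈ B, ρ.normalizedJacquet t m x ∈ B) ∧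
      ∀ x, ∃ a ∈ A, ∃ b ∈ B, x = a + b := by
  haveI : FiniteDimensional ℂ (t.restrict N.toRepresentation).Coinvariants := Module.finite_of_finrank_eq_succ hN
  haveI : FiniteDimensional ℂ (t.restrict N'.toRepresentation).Coinvariants := Module.finite_of_finrank_eq_succ hN'
  refine ⟨LinearMap.range (Representation.jacquetMap t (Subrepresentation.subtypeIntertwiningMap N)).toLinearMap,
    LinearMap.range (Representation.jacquetMap t (Subrepresentation.subtypeIntertwiningMap N')).toLinearMap,
    inferInstance, inferInstance,
    (LinearMap.finrank_range_le _).trans (le_of_eq hN), (LinearMap.finrank_range_le _).trans (le_of_eq hN'), ?_, ?_, ?_⟩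
  · intro m x hx
    obtain ⟨z, rfl⟩ := LinearMap.mem_range.1 hx
    refine LinearMap.mem_range.2 ⟨N.toRepresentation.normalizedJacquet t m z, ?_⟩
    rw [Representation.IntertwiningMap.toLinearMap_apply, Representation.IntertwiningMap.toLinearMap_apply, Representation.jacquetMap_normalizedJacquet]
  · intro m x hx
    obtain ⟨z, rfl⟩ := LinearMap.mem_range.1 hx
    refine LinearMap.mem_range.2 ⟨N'.toRepresentation.normalizedJacquet t m z, ?_⟩
    rw [Representation.IntertwiningMap.toLinearMap_apply, Representation.IntertwiningMap.toLinearMap_apply, Representation.jacquetMap_normalizedJacquet]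
  · intro x
    obtain ⟨f, rfl⟩ := Representation.Coinvariants.mk_surjective _ x
    have hf : f ∈ N.toSubmodule ⊔ N'.toSubmodule := by rw [hsup]; exact Submodule.mem_top
    obtain ⟨n, hn, n', hn', hnn⟩ := Submodule.mem_sup.1 hf
    refine ⟨Representation.jacquetMap t (Subrepresentation.subtypeIntertwiningMap N) (Representation.Coinvariants.mk (t.restrict N.toRepresentation) ⟨n, hn⟩),
      LinearMap.mem_range.2 ⟨_, rfl⟩,
      Representation.jacquetMap t (Subrepresentation.subtypeIntertwiningMap N') (Representation.Coinvariants.mk (t.restrict N'.toRepresentation) ⟨n', hn'⟩),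
      LinearMap.mem_range.2 ⟨_, rfl⟩, ?_⟩
    rw [Representation.jacquetMap_mk, Representation.jacquetMap_mk, ← map_add, ← hnn]
    rfl

end GenericJacquet

/-! ## §4 `U(Φ₃)(L⁺_v)`, `v` non-split, `wχ = χ`: a reducible `i_G(χ)` has `r_B(m) = χ(m) · id` -/

section CM

variable (L : Type) [Field L] [NumberField L] [IsCMField L] (v : HeightOneSpectrum (𝓞 ↥(maximalRealSubfield L)))
  (hns : ∀ w : PlacesOver L v, IsCMField.complexConj L • w.1 = w.1)

include hns in
set_option synthInstance.maxHeartbeats 400000 in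
set_option maxHeartbeats 8000000 in
-- statement∕proof-heavy: the `SmoothInd` carrier of `cmPrincipalSeries`, its subrepresentations and their Jacquet modules (class of ★ LdsRedTwo §2 ∕ ★ B6a §3)
/-- **«JACQUET SCALAR OF A REDUCIBLE `w`-FIXED `i_G(χ)`».**  `v` non-split, `χ₁, χ₂` continuous with `wχ = χ` (`cmWeylTorusCharPair = cmTorusCharPair`); if `i_G(χ₁, χ₂)` has a
`G`-stable `⊥ ≠ N ≠ ⊤`, then `T` acts on the normalised Jacquet module `r_B i_G(χ₁, χ₂)` by the scalar `χ`: `r_B(m) x = χ(m) • x` for all `m ∈ T` and all classes `x`.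
Proof: `i_G(χ)` is unitary (§1) hence completely reducible (★ `isSemisimpleRepresentation_cmPrincipalSeries` [BernsteinZelevinsky1976, 2.25 (c)]); `N` and its complement `N'` have
one-dimensional Jacquet modules (★ [Casselman1995, Prop. 7.1.3] over ★ N1 `dim = 2`, ★ N2, exactness ★ `isLimitOfCompactOpen_cmUnipotentU`), whose images in `r_B i_G(χ)` are
`T`-stable lines spanning it (functoriality ★ `jacquetMap`); and `(r_B(m) − χ(m))² = 0` (★ closed cell, ★ N1 (T-ℓ), `wχ = χ`), so §2 applies.  This is the contrapositive core of
Keys' irreducibility criterion at the `w`-fixed unitary points: «the commuting algebra of `Ind_P^G λ` has dimension `|R|`».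
[cite: Keys1984, §3 Thms. 1–3 pp. 118–119; §7 Thm. (1) p. 126] [cite: Rogawski1990, §12.2 (3) pp. 173–174] [cite: Casselman1995, §6.3–6.4, Lemma 7.1.1 (a), Prop. 7.1.3]
[cite: BernsteinZelevinsky1977, Prop. 1.9, §2.3] -/
theorem normalizedJacquet_eq_smul_of_reducible
    (χ₁ : (LocalRing L v)ˣ →* ℂˣ) (χ₂ : ↥(normOneUnits (conjLocal L (IsCMField.complexConj L) v)) →* ℂˣ)
    (h1 : Continuous fun x => ((χ₁ x : ℂˣ) : ℂ)) (h2 : Continuous fun x => ((χ₂ x : ℂˣ) : ℂ))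
    (hw : cmWeylTorusCharPair L v χ₁ χ₂ = cmTorusCharPair L v χ₁ χ₂)
    (hred : ∃ N : Subrepresentation (cmPrincipalSeries L 3 v (cmTorusCharPair L v χ₁ χ₂)), N ≠ ⊥ ∧ N ≠ ⊤) :
    haveI := locallyCompactSpace_cmBorelU L 3 v
    ∀ (m : ↥(cmBorelTriple L 3 v).M) (x : ((cmBorelTriple L 3 v).restrict (cmPrincipalSeries L 3 v (cmTorusCharPair L v χ₁ χ₂))).Coinvariants),
      (cmPrincipalSeries L 3 v (cmTorusCharPair L v χ₁ χ₂)).normalizedJacquet (cmBorelTriple L 3 v) m x = ((cmTorusCharPair L v χ₁ χ₂ m : ℂˣ) : ℂ) • x := by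
  haveI := locallyCompactSpace_cmBorelU L 3 v
  intro m x
  -- (U) unitarity and complete reducibility: an invariant complement `N'` of `N`, again `⊥ ≠ N' ≠ ⊤`
  -- (every `obtain` below destructs a HYPOTHESIS: `rcases` on a term would `generalize` it over this large goal)
  have hSS := F0P3cStCharTSPrincipalSeriesUnitary.isSemisimpleRepresentation_cmPrincipalSeries L 3 v (cmTorusCharPair L v χ₁ χ₂)
    (norm_cmTorusCharPair_eq_one_of_weylFixed L v hns χ₁ χ₂ h1 h2 hw)
  obtain ⟨N, hNb, hNt⟩ := hred
  have hexc := hSS.exists_isCompl N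
  obtain ⟨N', hc⟩ := hexc
  have hN'b : N' ≠ ⊥ := fun h => hNt (eq_top_of_isCompl_bot (h ▸ hc))
  have hN't : N' ≠ ⊤ := fun h => hNb (eq_bot_of_isCompl_top (h ▸ hc))
  -- Jacquet data: `dim r_B(I) = 2` (★ N1), smoothness, `dim r_B(N) = dim r_B(N') = 1` [Casselman1995, Prop. 7.1.3]
  have key := finiteDimensional_finrank_eq_two_of_U3PrincipalSeriesJacquetFiltration L
    (F0P3U3PrincipalSeriesJacquetFiltrationHolds.U3PrincipalSeriesJacquetFiltration_holds L) v hns χ₁ χ₂ h1 h2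
  haveI := key.1
  have hsm := F0P3U3LengthLeTwoOfEmbeds.isSmooth_cmPrincipalSeries L v (cmTorusCharPair L v χ₁ χ₂)
  have hrk : ∀ {M : Subrepresentation (cmPrincipalSeries L 3 v (cmTorusCharPair L v χ₁ χ₂))}, M ≠ ⊥ → M ≠ ⊤ →
      Module.finrank ℂ ((cmBorelTriple L 3 v).restrict M.toRepresentation).Coinvariants = 1 := fun hb ht =>
    Representation.finrank_coinvariants_eq_one_of_ne_bot_of_ne_top (cmBorelTriple L 3 v)
      (F0P3UnipotentLimitCompactOpen.isLimitOfCompactOpen_cmUnipotentU L v) hsm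
      (F0P3U3LengthLeTwoOfEmbeds.nontrivial_coinvariants_of_isConstituentOf_cmPrincipalSeries L
        (F0P3U3PrincipalSeriesLettersHold.u3PrincipalSeriesConstituentEmbeds_holds L) v hns χ₁ χ₂ h1 h2)
      key.2 hb ht
  -- the two stable lines (§3, generic) from `N ⊔ N' = ⊤`
  have hsup : N.toSubmodule ⊔ N'.toSubmodule = ⊤ := congrArg Subrepresentation.toSubmodule (codisjoint_iff.1 hc.codisjoint)
  have hlines := exists_stable_lines_of_sup_eq_top (cmBorelTriple L 3 v) (cmPrincipalSeries L 3 v (cmTorusCharPair L v χ₁ χ₂)) N N' hsup (hrk hNb hNt) (hrk hN'b hN't)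
  obtain ⟨A, B, hfA, hfB, hrA, hrB, hA, hB, hsum⟩ := hlines
  -- the ★ packages and §2
  have HC := F0P3U3PrincipalSeriesJacquetClosedCell.closedCell_cmPrincipalSeries L v (cmTorusCharPair L v χ₁ χ₂)
  have HU := F0P3U3PrincipalSeriesJacquetFiltrationHolds.finrank_le_one_cmPrincipalSeries L v hns (cmTorusCharPair L v χ₁ χ₂)
  have HT := F0P3U3PrincipalSeriesOpenCellTorusChar.torus_normalizedJacquet_openCellLine_eq_weylChar L v hns χ₁ χ₂ h1 h2
  exact apply_eq_smul_of_stable_lines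
    (mk := ⇑(Representation.Coinvariants.mk ((cmBorelTriple L 3 v).restrict (cmPrincipalSeries L 3 v (cmTorusCharPair L v χ₁ χ₂)))))
    (ev := fun f => f.toFun 1)
    (J := fun m' => ⇑((cmPrincipalSeries L 3 v (cmTorusCharPair L v χ₁ χ₂)).normalizedJacquet (cmBorelTriple L 3 v) m'))
    (χc := fun m' => ((cmTorusCharPair L v χ₁ χ₂ m' : ℂˣ) : ℂ))
    (wχc := fun m' => ((cmWeylTorusCharPair L v χ₁ χ₂ m' : ℂˣ) : ℂ))
    (fun m' y z => map_add _ y z) (fun m' c y => map_smul _ c y)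
    HC HU HT (fun m' => by rw [hw]) A B hfA hfB hrA hrB hA hB hsum m x

include hns in
set_option synthInstance.maxHeartbeats 400000 in
set_option maxHeartbeats 8000000 in
-- statement-heavy (as above)
/-- **The same in the SOCKET's spelling of `wχ = χ`** (`sig_K2E3IrregularReducibleCaseThree`: `cmTorusCharPair L v χ₁ χ₂ = cmTorusCharPair L v (conjInvChar σ χ₁) χ₂`, which IS
`cmWeylTorusCharPair L v χ₁ χ₂` by ★ `cmWeylTorusCharPair_eq`, `rfl`): a reducible irregular `i_G(χ₁, χ₂)` at a non-split `v` has `r_B(m) = χ(m) · id` on its Jacquet module.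
[cite: Keys1984, §7 Thm. (1) p. 126] [cite: Rogawski1990, §12.2 (3) pp. 173–174] -/
theorem normalizedJacquet_eq_smul_of_reducible_irregular
    (χ₁ : (LocalRing L v)ˣ →* ℂˣ) (χ₂ : ↥(normOneUnits (conjLocal L (IsCMField.complexConj L) v)) →* ℂˣ)
    (h1 : Continuous fun x => ((χ₁ x : ℂˣ) : ℂ)) (h2 : Continuous fun x => ((χ₂ x : ℂˣ) : ℂ))
    (hirr : cmTorusCharPair L v χ₁ χ₂ = cmTorusCharPair L v (conjInvChar (conjLocal L (IsCMField.complexConj L) v) χ₁) χ₂)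
    (hred : ∃ N : Subrepresentation (cmPrincipalSeries L 3 v (cmTorusCharPair L v χ₁ χ₂)), N ≠ ⊥ ∧ N ≠ ⊤) :
    haveI := locallyCompactSpace_cmBorelU L 3 v
    ∀ (m : ↥(cmBorelTriple L 3 v).M) (x : ((cmBorelTriple L 3 v).restrict (cmPrincipalSeries L 3 v (cmTorusCharPair L v χ₁ χ₂))).Coinvariants),
      (cmPrincipalSeries L 3 v (cmTorusCharPair L v χ₁ χ₂)).normalizedJacquet (cmBorelTriple L 3 v) m x = ((cmTorusCharPair L v χ₁ χ₂ m : ℂˣ) : ℂ) • x :=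
  normalizedJacquet_eq_smul_of_reducible L v hns χ₁ χ₂ h1 h2 ((cmWeylTorusCharPair_eq L v χ₁ χ₂).trans hirr.symm) hred

end CM

end Summit.HodgeConjecture.HodgeConjecture.Cruxes.H413.K2E3IrregularReducibleCaseThreeJacquetScalar

end
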